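import Summits.QuantumFields.YangMills.Theorems.BalabanUVNodesProp4AtRecordConeRadiusPr
import Summits.QuantumFields.YangMills.Theorems.BalabanUVNodesN07FramedLettersOfThm312313
import HarnessLib

/-!
# [B11] PROP. 4 AT THE RECORD, FRAMED EDITION (ρ-frame-min) — FROM ONE (3.133)-SHAPED LETTER FOR THE FRAMED `H₁(U₀)` (entry bounds of `H1prOfRecordAtBg … 𝔥` through n07-e's generic
# `entry0`∕`entry1`∕`colOp`), the ON-CONE entry letter of `D C^{sl,pr}`, (KL-N)ᵖʳ, print's (14) and the frame datum's displayed debts — twin of ✓`BalabanUVNodesProp4KernelLetterHOfEntryBounds`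

Cell `pub-ymgap` ∕ `ym-nodeO-ideate`, porter lineage `ymgap-nodeO-port-PTB-1` (gen 9); re-press (B) of director-ym g23 №608 (ROAD WORD FINAL), the last of PT-B's letter-readers; filed behind
(A3) ✓p829152, ✓`…Prop4AtRecordConeRadiusPr` and dag-n07-e's generic carriers ✓`…N07KernelEntriesOfRecord` (`klH_of_entryBounds T`, `entry0`∕`entry1`∕`colOp`) + framed letter
✓`…N07FramedLettersOfThm312313` (`prop4LetterHPrAtRecord_of_entryBounds`) — which made the deferral (d1) of my 17:34Z line unnecessary: the suppliers ARE generic in `T`.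
`--kind proof --supports stmt-QuantumFields-27238 --as helper`; count-neutral; NEW basename, append-nothing.  [B9] = [Balaban1985BackgroundPropagators]; [B11] = [Balaban1985Variational];
[B7] = [Balaban1985Averaging].

WHAT IS PROVED (0 def, 0 sorry, axioms standard; ns `Summit.QuantumFields.YangMills.Theorems.Prop4UniformAtRecord`):
★★★ `prop4UniformPrAtRecord_node00_of_h1EntryBounds_coneLetter` — `Prop4UniformPrAtRecord … 𝔥 … r′ Gp C₄ R′` (`0 < k ≤ m + K`, every site in `Ω_k`, any `0 < r′ ≤ r(b)`) from: the entry
bounds `entry₀,₁(H₁^{pr}(U₀)) y″ y ≤ B₀e^{−ρd}` (giving BOTH (ℓa-H)ᵖʳ with `b = B₀·d(2(1+1∕ρ))^d` via n07-e ✓`prop4LetterHPrAtRecord_of_entryBounds` AND (KL-H)ᵖʳ with `hk = ‖colOp‖`,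
`Θ_H = Θ_H^w = L^{kd}·b` via ✓`klH_of_entryBounds`), (KL-N)ᵖʳ, the on-cone entry letter `g₀` of `D C^{sl,pr}` on `‖A‖ < 2r′` with window `2r′·Θ_H·(2d·g₀) ≤ ½`, print's (14) below `k`,
`‖J‖ ≤ nJ`, and the datum's four displayed debts `hc`∕(hdom)∕(hnear)∕(hmap)∕(hderiv) — the rest is ✓`prop4UniformPrAtRecord_node00_of_coneLetter_radius`.

HONEST FRAMING.  Glue; the entry bounds ((R1)-class, [B9] Thm 3.12 (3.133)), (KL-N)ᵖʳ, the on-cone letter ([B7] (157)-class) and the frame debts are DISPLAYED binders, NOT proved; no frame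
is constructed in the tree yet ((A1) is node00-def-Y's); (R1)∕(R2) OPEN; K0ᴬ ⟨stmt-QuantumFields-27238⟩ NOT closed; NODE O 0∕1; COUNT 8∕28 · K 1∕4 UNMOVED; finite `𝕋⁴_{L^K}` at fixed ε —
NOT continuum ∕ ℝ⁴ ∕ OS ∕ Clay; **the Yang–Mills mass gap (Clay) is NOT proved by any of this.**  No `sorry`, `instance`, `notation`, `set_option`; standard axioms.
-/

noncomputable section

open scoped Matrix Matrix.Norms.L2Operator InnerProductSpace ComplexConjugate BigOperators

namespace Summit.QuantumFields.YangMills.Theorems.Prop4UniformAtRecord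

open Literature.MathematicalPhysics.QuantumFieldTheory.Balaban1983to89
open Literature.MathematicalPhysics.QuantumFieldTheory.Balaban1983to89.Node00
open T4Continuum BlockAveraging
open B10Eq42TorusConstraint (bondsIn)
open B10Eq38TorusDomains (toFine)
open B9SectCLatticeCarrier (Bond)
open B11Eq103H1Complex (SiteL2K)
open B11Eq115Space (NegSup NegSize levWeight)
open B11Eq90Transpose (single115)
open B11Eq90V0primeCurrent (flat115)
open B11Eq111FrakG (nabla115)
open Summit.QuantumFields.YangMills.BalabanUVNodes.N07KernelEntriesOfRecord (colOp entry0 entry1 klH_of_entryBounds)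
open Summit.QuantumFields.YangMills.BalabanUVNodes.N07FramedLettersOfThm312313 (prop4LetterHPrAtRecord_of_entryBounds)

section Record

variable (F : T4Family) (N : ℕ) [NeZero N] (K k : ℕ) (Ω : ℕ → Set (Site (F.P K) 0)) (U₀ : GaugeField (F.P K) 0 (SU N))
variable [Fact (0 < (F.L : ℝ))] [Fact (0 < (F.P K).eta k)] [Fact (0 < c0Rec F K k)] [Fact (∀ c, 0 < wBRec F K k c)] (𝔥 : FrameDatum (F.P K) N k U₀)
  (levB : PBond (F.P K) k → ℕ) (a : ℝ)
  (hpos : ∀ x, x ≠ 0 → 0 < RCLike.re ⟪x, laplaceAOfRecord F N k U₀ (QprOfRecord F N k U₀ 𝔥) (QprimeOfRecord F N k U₀) a x⟫_ℂ)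
  (hQ : Function.Surjective (QprOfRecord F N k U₀ 𝔥))

/-- ★★★ **[B11] PROP. 4 (97)–(98) AT THE RECORD IN THE NODE-00 REGIME FROM ONE LETTER FOR THE FRAMED `H₁(U₀)`** (twin of ✓`prop4UniformAtRecord_node00_of_h1EntryBounds_coneLetter`) — the
(3.133)-shaped entry bounds `entry₀,₁(H1prOfRecordAtBg … 𝔥) y″ y ≤ B₀e^{−ρd(y″,y)}` give BOTH (ℓa-H)ᵖʳ (n07-e ✓`prop4LetterHPrAtRecord_of_entryBounds`, `b = B₀·d(2(1+1∕ρ))^d`) AND (KL-H)ᵖʳ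
(✓`klH_of_entryBounds` at `T := H1prOfRecordAtBg … 𝔥`, `hk = ‖colOp‖_op`, `Θ_H = Θ_H^w = L^{kd}·B₀·d(2(1+1∕ρ))^d`); the rest as in ✓`prop4UniformPrAtRecord_node00_of_coneLetter_radius`: (KL-N)ᵖʳ, the
on-cone entry letter `g₀` of `D C^{sl,pr}` on `‖A‖ < 2r′` with window `2r′·Θ_H·(2d·g₀) ≤ ½`, print's (14) below `k`, `‖J‖ ≤ nJ`, any radius `0 < r′ ≤ r(b)`, and the datum's displayed
debts `hc`∕(hdom)∕(hnear)∕(hmap)∕(hderiv).  HONEST: glue; the letters are DISPLAYED.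
[cite: Balaban1985Variational, Prop. 4 (97)–(98) pp.292–293, (14) p.280, (46) p.285, (86)–(89) p.291; Balaban1985BackgroundPropagators, (3.133) p.422, Thm 3.12 pp.423–424; Balaban1985Averaging, Proposition 5 (157) p.42, (92) p.31; Balaban1984PropagatorsII, (2.61) p.234] -/
theorem prop4UniformPrAtRecord_node00_of_h1EntryBounds_coneLetter [DecidableEq (PBond (F.P K) k)]
    (Gp : SiteL2K ℂ (F.P K).d (fun _ => (F.P K).sitesPerDir 0) (c0Rec F K k) (WRec N) →ₗ[ℂ]
      SiteL2K ℂ (F.P K).d (fun _ => (F.P K).sitesPerDir 0) (c0Rec F K k) (WRec N))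
    {α nJ : ℝ} (hkpos : 0 < k) (hkm : k ≤ (F.P K).m + (F.P K).K) (hΩ : ∀ x, x ∈ Ω k) (hα0 : 0 ≤ α) (hα : α * (11000000 * N) ≤ 1)
    (hreg : ∀ j, j < k → PlaqSmall (α * ((F.L : ℝ) ^ j * (F.P K).eta k) ^ 2) (Averaging.iter (avOfRecord F N K) j U₀))
    -- the frame datum's displayed debts: window, near-one (scaled), block-locality
    {c𝔥 : ℝ} (hc : c𝔥 ≤ 1000)
    (hdom : ∀ Y : PBond (F.P K) 0 → Matrix (Fin N) (Fin N) ℂ, (∀ b, (Y b).trace = 0) → (F.L : ℝ) ^ k * ‖Y‖ < 1 / (25000000000 * (F.L : ℝ) * N) →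
      expOver U₀ Y ∈ 𝔥.dom)
    (hnear : ∀ Y : PBond (F.P K) 0 → Matrix (Fin N) (Fin N) ℂ, (∀ b, (Y b).trace = 0) → (F.L : ℝ) ^ k * ‖Y‖ < 1 / (25000000000 * (F.L : ℝ) * N) →
      ∀ y : Site (F.P K) k, ‖𝔥.map (expOver U₀ Y) y - 1‖ ≤ c𝔥 * ((F.L : ℝ) ^ k * ‖Y‖) ∧ ‖𝔥.inv (expOver U₀ Y) y - 1‖ ≤ c𝔥 * ((F.L : ℝ) ^ k * ‖Y‖))
    (hmap : ∀ Y : Set (Site (F.P K) 0), (∀ i, i < k → ∀ s : Site (F.P K) i, toFine i s ∈ Y ↔ toFine (i + 1) (blockOf s) ∈ Y) →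
      ∀ V V' : PBond (F.P K) 0 → Matrix (Fin N) (Fin N) ℂ, (∀ b : PBond (F.P K) 0, b ∈ bondsIn 0 Y → V b = V' b) →
      ∀ y : Site (F.P K) k, toFine k y ∈ Y → 𝔥.map V y = 𝔥.map V' y ∧ 𝔥.inv V y = 𝔥.inv V' y)
    (hderiv : ∀ Y : Set (Site (F.P K) 0), (∀ i, i < k → ∀ s : Site (F.P K) i, toFine i s ∈ Y ↔ toFine (i + 1) (blockOf s) ∈ Y) →
      ∀ Z Z' : PBond (F.P K) 0 → Matrix (Fin N) (Fin N) ℂ, (∀ b : PBond (F.P K) 0, b ∈ bondsIn 0 Y → Z b = Z' b) →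
      ∀ y : Site (F.P K) k, toFine k y ∈ Y → 𝔥.deriv Z y = 𝔥.deriv Z' y)
    -- the (3.133)-shaped entry bounds of the FRAMED `H₁(U₀)` (zeroth and first entries, n07-e's generic `entry0`∕`entry1`)
    {B₀ ρ : ℝ} (hB₀ : 0 ≤ B₀) (hρ : 0 < ρ)
    (h0 : ∀ y y' : PBond (F.P K) k, entry0 F N K k Ω U₀ levB (H1prOfRecordAtBg F N K k Ω U₀ 𝔥 levB a hpos hQ) y y' ≤ B₀ * Real.exp (-(ρ * (Site.tdist y.src y'.src : ℝ))))
    (h1 : ∀ y y' : PBond (F.P K) k, entry1 F N K k Ω U₀ levB (H1prOfRecordAtBg F N K k Ω U₀ 𝔥 levB a hpos hQ) y y' ≤ B₀ * Real.exp (-(ρ * (Site.tdist y.src y'.src : ℝ))))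
    -- the radius
    {r' : ℝ} (hr'0 : 0 < r')
    (hr'le : letI C₂ : ℝ := 32000000000000000 * (F.L : ℝ) * N
      letI c₄ : ℝ := 1 / (200000000000 * (F.L : ℝ) * N)
      letI b : ℝ := B₀ * ((F.P K).d * (2 * (1 + 1 / ρ)) ^ (F.P K).d)
      r' ≤ min (c₄ / 4) (min (1 / 2) (1 / (16 * (b * C₂ + 1)))))
    -- the on-cone entry letter of `D C^{sl}` on `‖A‖ < 2r′`, and the window against `Θ_H = L^{kd}·B₀·d·(2(1+1/ρ))^d`
    {g₀ : ℝ} (hg₀ : 0 ≤ g₀)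
    (hg : ∀ A : Space115Lit F N K k Ω U₀, ‖A‖ < r' + r' → ∀ (bb : Bond (F.P K).d (fun _ => (F.P K).sitesPerDir 0)) (X : Matrix (Fin N) (Fin N) ℂ) (c : PBond (F.P K) k),
      (bondToLit (F.P K) 0).symm bb ∈ bondsIn 0 {x : Site (F.P K) 0 | B14.Eq22Determines.blockIter k x = c.src ∨ B14.Eq22Determines.blockIter k x = c.tgt} →
      ‖NegSup.equiv (levWeight (F.L : ℝ) ((F.P K).eta k) levB 0) (Matrix (Fin N) (Fin N) ℂ)
        (fderiv ℂ (CslprOfRecord F N K k Ω U₀ 𝔥 levB) A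
          (single115 (lev₁ := pairLevLit F Ω k) (Dc := nabla115 ((F.P K).eta k) (unitsOfRecord F N U₀)) bb X)) c‖ ≤ g₀ * ‖A‖ * ‖X‖)
    (hq : (r' + r') * (((((F.P K).L ^ (F.P K).d) ^ k : ℕ) : ℝ) * (B₀ * ((F.P K).d * (2 * (1 + 1 / ρ)) ^ (F.P K).d))) * (2 * ((F.P K).d : ℝ) * g₀) ≤ 1 / 2)
    -- (KL-N)
    {hk' : Bond (F.P K).d (fun _ => (F.P K).sitesPerDir 0) → PBond (F.P K) k → ℝ} (hk'0 : ∀ b' y, 0 ≤ hk' b' y)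
    (hNk : ∀ (y : PBond (F.P K) k) (Z : Matrix (Fin N) (Fin N) ℂ) (b' : Bond (F.P K).d (fun _ => (F.P K).sitesPerDir 0)),
      ‖NegSup.equiv (levWeight (F.L : ℝ) ((F.P K).eta k) (bondLevLit F Ω k) 3) (Matrix (Fin N) (Fin N) ℂ)
        (DeltaPiCurOfRecord F N K k Ω U₀ Gp (QprimeOfRecord F N k U₀) (H1prOfRecordAtBg F N K k Ω U₀ 𝔥 levB a hpos hQ
          ((NegSup.equiv (levWeight (F.L : ℝ) ((F.P K).eta k) levB 0) (Matrix (Fin N) (Fin N) ℂ)).symm (Pi.single y Z)))) b'‖ ≤ hk' b' y * ‖Z‖)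
    {Θ' : ℝ} (hΘ'0 : 0 ≤ Θ')
    (hΘ' : ∀ (bb : Bond (F.P K).d (fun _ => (F.P K).sitesPerDir 0)) (y : PBond (F.P K) k),
      ∑ b', levWeight (F.L : ℝ) ((F.P K).eta k) (bondLevLit F Ω k) 3 bb / levWeight (F.L : ℝ) ((F.P K).eta k) (bondLevLit F Ω k) 1 b' * hk' b' y ≤ Θ')
    {N₁ : ℝ} (hN₁0 : 0 ≤ N₁)
    (hN₁ : ∀ b', ∑ y, levWeight (F.L : ℝ) ((F.P K).eta k) (bondLevLit F Ω k) 3 b' / levWeight (F.L : ℝ) ((F.P K).eta k) levB 0 y * hk' b' y ≤ N₁)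
    (hJ : ‖JOfRecordAtBg F N K k Ω U₀‖ ≤ nJ) :
    letI C₂ : ℝ := 32000000000000000 * (F.L : ℝ) * N
    letI b : ℝ := B₀ * ((F.P K).d * (2 * (1 + 1 / ρ)) ^ (F.P K).d)
    letI ΘHw : ℝ := ((((F.P K).L ^ (F.P K).d) ^ k : ℕ) : ℝ) * (B₀ * ((F.P K).d * (2 * (1 + 1 / ρ)) ^ (F.P K).d))
    letI R' : ℝ := min r' ((1 - 4 * b * C₂ * (r' + r')) * (1 / 16))
    letI CV : ℝ := 1024 * (((F.P K).d - 1 : ℕ) : ℝ) * ((1 : ℝ) * 1) ^ 3 * N * (α * (1 : ℝ) ^ 2 + 1 / 16)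
        + (((F.P K).d - 1 : ℕ) : ℝ) * ((1 : ℝ) * 1) ^ 3 * (136 + 2 * ((1 : ℝ) * 1)) * N
    letI G : ℝ := 2 * ((F.P K).d : ℝ) * g₀
    letI θ₃ : ℝ := (2 * (1 / (1 - 4 * b * C₂ * (r' + r'))) + 1) * ΘHw * G / r'
    letI θE : ℝ := 2 * ΘHw * G * (1 / (1 - 4 * b * C₂ * (r' + r')))
    letI θE' : ℝ := 2 * Θ' * G * (1 / (1 - 4 * b * C₂ * (r' + r')))
    Prop4UniformPrAtRecord F N K k Ω U₀ 𝔥 levB a hpos hQ r' Gp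
      ((N * θ₃ * nJ + (N₁ * C₂ * (1 / (1 - 4 * b * C₂ * (r' + r'))) ^ 2 + N * θE')
        + N * θE * (N₁ * C₂ * (1 / (1 - 4 * b * C₂ * (r' + r'))) ^ 2) * R'
        + N * (1 + θE * R') * CV * (1 / (1 - 4 * b * C₂ * (r' + r'))) ^ 2)) R' := by
  have hb : 0 ≤ B₀ * ((F.P K).d * (2 * (1 + 1 / ρ)) ^ (F.P K).d) := by positivity
  obtain ⟨hk0, hHk', hΘ, hH1, hHw⟩ := klH_of_entryBounds F N K k Ω U₀ levB (H1prOfRecordAtBg F N K k Ω U₀ 𝔥 levB a hpos hQ) hΩ hkm hB₀ hρ h0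
  -- the one-block bound read with this statement's decidability instance inside `Pi.single` (instances are subsingletons)
  have hHk : ∀ (y : PBond (F.P K) k) (Z : Matrix (Fin N) (Fin N) ℂ) (b' : Bond (F.P K).d (fun _ => (F.P K).sitesPerDir 0)),
      ‖flat115 (H1prOfRecordAtBg F N K k Ω U₀ 𝔥 levB a hpos hQ
          ((NegSup.equiv (levWeight (F.L : ℝ) ((F.P K).eta k) levB 0) (Matrix (Fin N) (Fin N) ℂ)).symm (Pi.single y Z))) b'‖ ≤
        ‖colOp F N K k Ω U₀ levB (H1prOfRecordAtBg F N K k Ω U₀ 𝔥 levB a hpos hQ) y b'‖ * ‖Z‖ := fun y Z b' => by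
    convert hHk' y Z b' using 6
  exact prop4UniformPrAtRecord_node00_of_coneLetter_radius F N K k Ω U₀ 𝔥 levB a hpos hQ Gp hkpos hkm hb hΩ hα0 hα hreg hc hdom hnear hmap hderiv
    (prop4LetterHPrAtRecord_of_entryBounds (F := F) (N := N) K k Ω U₀ 𝔥 levB a hpos hQ hΩ hB₀ hρ h0 h1) hr'0 hr'le
    (hk := fun b' y => ‖colOp F N K k Ω U₀ levB (H1prOfRecordAtBg F N K k Ω U₀ 𝔥 levB a hpos hQ) y b'‖) hk0 hHk hΘ hH1 hΘ hHw hg₀ hg hq hk'0 hNk hΘ'0 hΘ' hN₁0 hN₁ hJ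

end Record

end Summit.QuantumFields.YangMills.Theorems.Prop4UniformAtRecord

end
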